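import Summits.HodgeConjecture.CorCM.HodgeLieAlgebraReductive
import Literature.Algebra.Lie.GoursatSimpleFactor
import HarnessLib

/-!
# Ideals of the Hodge Lie algebra of a complex abelian variety: dimensions `∉ {1, 2, 4, 5, 7}`

COR-CM (cell `pub-hodgecm2`, seat `b27` gen 47, count-neutral Mumford–Tate-rank ladder; theorems only, no definition, no named fact;
UNCONDITIONAL — nothing here uses or asserts HC_CM).  The semisimple part `𝔡 = [Lie Hg(H¹X), Lie Hg(H¹X)]` of the Hodge Lie algebra of EVERY
complex abelian variety is a semisimple Lie algebra (gen 36, `CorCM/HodgeLieAlgebraReductive`), and `Lie Hg(H¹X)` itself is semisimple when `X`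
has no factor of type IV.  Every ideal of a semisimple Lie algebra over a field of characteristic `0` has trivial radical
(`GoursatSimpleFactor.hasTrivialRadical_lieIdeal`: it is complemented by a commuting ideal), hence dimension `∉ {1, 2, 4, 5, 7}`
(`dim = rank + #roots`).  So:

* **`finrank_lieIdeal_hodgeLie_hodge_one_derived_ne`** — every Lie ideal of `𝔡` has dimension `∉ {1, 2, 4, 5, 7}` (every `X`);
* **`finrank_lieIdeal_hodgeLie_hodge_one_ne_of_hasNoTypeIVFactor`** — every Lie ideal of `Lie Hg(H¹X)` has dimension `∉ {1, 2, 4, 5, 7}`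
  when `X` has no factor of type IV (the case `I = ⊤` is gen 36's `t ∉ {2, 3, 5, 6, 8}`).
These are the codimension obstructions used by the product theorem (`CorCM/MumfordTateRankProductRigidFactors`: Goursat's graph case needs an
ideal of codimension `dim Lie Hg(H¹X₁)` in `Lie Hg(H¹X₂)`).

## References
* [Humphreys1972] J. E. Humphreys, *Introduction to Lie Algebras and Representation Theory*, GTM 9 (1972), §5.2, §8.4. [cite: Humphreys1972, §5.2]
* [MoonenZarhin1999LowDim] B. Moonen, Yu. G. Zarhin, Math. Ann. 315 (1999), §1 («no factors of Type 4» ⟺ `Hg` semisimple).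
  [cite: MoonenZarhin1999LowDim, §1]
-/

noncomputable section

open scoped TensorProduct
open CategoryTheory Module

namespace Summit.HodgeConjecture.CorCM

open Literature.AlgebraicGeometry.Motives
open Literature.AlgebraicGeometry.Motives.AbelianVariety
open Literature.AlgebraicGeometry.Motives.HodgeStructure
open Literature.AlgebraicGeometry.HodgeTheory

attribute [local instance 100] LieRing.ofAssociativeRing

variable [HodgeTensorFacts.{0, 0}] {X : AbelianVariety ℂ} {n : ℕ}

/-- **Every ideal of the semisimple part `[Lie Hg(H¹X), Lie Hg(H¹X)]` has dimension `∉ {1, 2, 4, 5, 7}`**, for EVERY complex abelian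
variety `X` (ideals of a semisimple Lie algebra have trivial radical; root count). [cite: Humphreys1972, §5.2] [cite: MoonenZarhin1999LowDim, §1] -/
theorem finrank_lieIdeal_hodgeLie_hodge_one_derived_ne (hX : IsSmoothProjective n X.X) :
    haveI := BettiUniverse.finite hX 1
    ∀ 𝔏 : LieSubalgebra ℚ (Module.End ℚ (bettiCohomology X.X 1)),
      𝔏.toSubmodule = Submodule.span ℚ {B | ∃ X' ∈ (BettiUniverse.hodge exists_isReal_hodgeModel_holds hX 1).hodgeLie,
        ∃ Y ∈ (BettiUniverse.hodge exists_isReal_hodgeModel_holds hX 1).hodgeLie, X' * Y - Y * X' = B} →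
      ∀ I : LieIdeal ℚ 𝔏, Module.finrank ℚ I ≠ 1 ∧ Module.finrank ℚ I ≠ 2 ∧ Module.finrank ℚ I ≠ 4 ∧ Module.finrank ℚ I ≠ 5 ∧
        Module.finrank ℚ I ≠ 7 := by
  haveI := BettiUniverse.finite hX 1
  intro 𝔏 h𝔏 I
  haveI : LieAlgebra.IsSemisimple ℚ 𝔏 := (isSemisimple_of_eq_hodgeLie_hodge_one_derived hX 𝔏 h𝔏).1
  haveI : Module.Finite ℚ 𝔏 := Module.Finite.of_injective 𝔏.toSubmodule.subtype Subtype.val_injective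
  exact Literature.Algebra.Lie.GoursatSimpleFactor.finrank_lieIdeal_ne (K := ℚ) I

/-- **Every ideal of `Lie Hg(H¹X)` has dimension `∉ {1, 2, 4, 5, 7}` when `X` has no factor of type IV** (`Lie Hg` is then semisimple).
[cite: Humphreys1972, §5.2] [cite: MoonenZarhin1999LowDim, §1] -/
theorem finrank_lieIdeal_hodgeLie_hodge_one_ne_of_hasNoTypeIVFactor (hX : IsSmoothProjective n X.X) (hA4 : HasNoTypeIVFactor X) :
    haveI := BettiUniverse.finite hX 1
    ∀ 𝔏 : LieSubalgebra ℚ (Module.End ℚ (bettiCohomology X.X 1)),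
      𝔏.toSubmodule = (BettiUniverse.hodge exists_isReal_hodgeModel_holds hX 1).hodgeLie →
      ∀ I : LieIdeal ℚ 𝔏, Module.finrank ℚ I ≠ 1 ∧ Module.finrank ℚ I ≠ 2 ∧ Module.finrank ℚ I ≠ 4 ∧ Module.finrank ℚ I ≠ 5 ∧
        Module.finrank ℚ I ≠ 7 := by
  haveI := BettiUniverse.finite hX 1
  intro 𝔏 h𝔏 I
  haveI : LieAlgebra.IsSemisimple ℚ 𝔏 := (isSemisimple_of_eq_hodgeLie_hodge_one_of_hasNoTypeIVFactor hX hA4 𝔏 h𝔏).1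
  haveI : Module.Finite ℚ 𝔏 := Module.Finite.of_injective 𝔏.toSubmodule.subtype Subtype.val_injective
  exact Literature.Algebra.Lie.GoursatSimpleFactor.finrank_lieIdeal_ne (K := ℚ) I

end Summit.HodgeConjecture.CorCM

end
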